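import Literature.MathematicalPhysics.QuantumFieldTheory.Balaban1983to89.T4CouplingMatching

/-!
# EriceRemainderEnclosureHistoryRenewalSharp — (E33e) the binder class of (E33) is STRICTLY LARGER than node U2's: a history
# family obeying NE4 as typed (`ScaleShiftRate c θ`) with history moduli of ROW TOTAL WEIGHT `≤ 2`, floor and sign, for which NO
# history-Lipschitz modulus has `FadingMemory` — the fading OSCILLATION of (E33a) carried by a non-fading MODULUS

Cell `pub-balaban`, β-function sub-cell, BINDER row D4 «RemainderConst leaves for Bałaban's split» (`HOME/BINDER-OWNERS.md`; owner
lineage `b2b-balaban-beta-an4`; this file by co-owner #2 lineage `b2b-balaban-beta-d4-p2`, generation 35), β-FLOW TEAM duty (1),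
FREEZE (0) honoured (def-free: the family is a HYPOTHESIS `hβ` on an abstract `β : FlowStep.HBeta`, as in (E32b)
`EriceRemainderEnclosureHistoryUniquenessSharp`; no leaf, no new hypothesis shape).  The sharp side of station (E33) over node U2's
`T4CouplingMatching` (`ScaleShiftRate`, `HistLipschitz`, `FadingMemory`, `EventualLowerH` BY NAME).

HONEST FRAMING.  The family below is a TEST OBJECT for the typed hypothesis SHAPES of node U2 — NOT a model of Bałaban's (1.22), about
which nothing is asserted; [folklore] real analysis.  It shows that (E33c) `EriceRemainderEnclosureHistoryRenewalRate.disc_le_stretched_sign`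
∕ (E33d) `…RenewalContinuum.continuum_of_sign` apply where node U2's `disc_le_of_fadingMemory` ∕ `injectedRate_of_runs_eventual` ∕
`T4ContinuumCoupling.continuumRunning_of_runs_eventual` have NO instance (no fading modulus exists); it does NOT show that the geometric
SHAPE of node U2's conclusion fails for this family (a lower bound on two-run discrepancies is not attempted) — the sharpness of the
stretched-exponential shape stays OPEN.  Row D4 class UNCHANGED (critical-path width 0; instance 0∕1; D4 DISCHARGE NO DATE); NOT B12 Thm 2,
NOT BetaPertH, NOT continuum, NOT Clay.  HONEST DEPENDENCY: continuum YM on T⁴ ⇐ BetaPertH ∧ nine spine estimates (0/9 proved); BetaPertH ⇐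
(D1) ∧ (D4) ∧ CAP+tail; G-an2-4 gates asym, D1 and NE2/3/4.

THE FAMILY (stationary, «fast small-amplitude wiggles in old entries»).  `β_{k+1}(p_0, …, p_k) = b + Σ_{i≤k} min(c·θ^{k−i}, p_i∕(k−i+1)²)`:
the entry of AGE `a = k − i` enters through a ramp of SLOPE `1∕(a+1)²` CLIPPED at height `c·θ^a`.  Hence (§1): NE4 as typed holds —
deleting the oldest coupling removes exactly the age-`(k+1)` term, of size `≤ cθ^{k+1} ≤ cθ^k` (`fam_scaleShiftRate`); the moduli
`Λ k i = 1∕(k−i+1)²` serve (`fam_histLipschitz`; `min` is 1-Lipschitz) with ROW total weight `Σ_{a≤k} 1∕(a+1)² ≤ 2` (`fam_rows_le_two`);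
floor and sign `β ≥ b` (`fam_lower`), bound `β ≤ b + c∕(1−θ)` (`fam_upper`).  And (§2): EVERY modulus `Λ′` with `HistLipschitz Λ′ γ β`
has `Λ′ k 0 ≥ 1∕(k+1)²` (`fam_weight_ge`: two histories in the box differing in the bare slot inside the ramp), so `FadingMemory C θ′ Λ′`
fails for every `C` and every `θ′ ∈ [0,1[` (`fam_not_fadingMemory`: `(k+1)²θ′^k → 0`).  So for `γ` small against `b` (smallness
`2·(γ³ + 2γ∕b) < 1`) every binder of (E33c)∕(E33d)'s sign form is met (`fam_binders_E33`) while node U2's decay binder is unavailable.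
-/

noncomputable section
open Finset Filter Topology

namespace Summit.QuantumFields.BalabanUV.Beta.EriceRemainderEnclosureHistoryRenewalSharp

open Literature.MathematicalPhysics.QuantumFieldTheory.Balaban1983to89
open Literature.MathematicalPhysics.QuantumFieldTheory.Balaban1983to89.FlowStep
open Literature.MathematicalPhysics.QuantumFieldTheory.Balaban1983to89.T4CouplingMatching

variable {β : HBeta} {b c θ : ℝ}

/-! ## §1 The family meets NE4 as typed, has row-bounded moduli, floor, sign and bound -/

/-- **NE4 AS TYPED HOLDS**: deleting the oldest coupling removes exactly the oldest term `min(cθ^{k+1}, w_0∕(k+2)²) ∈ [0, cθ^{k+1}]`, so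
`ScaleShiftRate c θ γ β` (`c ≥ 0`, `0 ≤ θ ≤ 1`). [folklore] -/
theorem fam_scaleShiftRate
    (hβ : ∀ (k : ℕ) (p : Fin (k + 1) → ℝ),
      β k p = b + ∑ i : Fin (k + 1), min (c * θ ^ (k - (i : ℕ))) (p i / (((k - (i : ℕ) : ℕ) : ℝ) + 1) ^ 2))
    (hc : 0 ≤ c) (hθ0 : 0 ≤ θ) (hθ1 : θ ≤ 1) (γ : ℝ) : ScaleShiftRate c θ γ β := by
  intro k w hw
  have hw0 : 0 < w 0 := ((mem_box.mp hw) 0).1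
  rw [hβ (k + 1) w, hβ k (Fin.tail w), Fin.sum_univ_succ]
  have htail : ∑ i : Fin (k + 1), min (c * θ ^ (k + 1 - ((Fin.succ i : Fin (k + 2)) : ℕ)))
        (w (Fin.succ i) / (((k + 1 - ((Fin.succ i : Fin (k + 2)) : ℕ) : ℕ) : ℝ) + 1) ^ 2)
      = ∑ i : Fin (k + 1), min (c * θ ^ (k - (i : ℕ))) (Fin.tail w i / (((k - (i : ℕ) : ℕ) : ℝ) + 1) ^ 2) := by
    refine sum_congr rfl fun i _ => ?_
    have e : k + 1 - ((Fin.succ i : Fin (k + 2)) : ℕ) = k - (i : ℕ) := by simp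
    rw [e]; rfl
  rw [htail]
  have e0 : ((0 : Fin (k + 2)) : ℕ) = 0 := rfl
  simp only [e0, Nat.sub_zero]
  have hmin0 : 0 ≤ min (c * θ ^ (k + 1)) (w 0 / (((k + 1 : ℕ) : ℝ) + 1) ^ 2) :=
    le_min (mul_nonneg hc (pow_nonneg hθ0 _)) (by positivity)
  have hmin1 : min (c * θ ^ (k + 1)) (w 0 / (((k + 1 : ℕ) : ℝ) + 1) ^ 2) ≤ c * θ ^ k :=
    (min_le_left _ _).trans (mul_le_mul_of_nonneg_left (pow_le_pow_of_le_one hθ0 hθ1 (Nat.le_succ k)) hc)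
  rw [show b + (min (c * θ ^ (k + 1)) (w 0 / (((k + 1 : ℕ) : ℝ) + 1) ^ 2)
      + ∑ i : Fin (k + 1), min (c * θ ^ (k - (i : ℕ))) (Fin.tail w i / (((k - (i : ℕ) : ℕ) : ℝ) + 1) ^ 2))
      - (b + ∑ i : Fin (k + 1), min (c * θ ^ (k - (i : ℕ))) (Fin.tail w i / (((k - (i : ℕ) : ℕ) : ℝ) + 1) ^ 2))
      = min (c * θ ^ (k + 1)) (w 0 / (((k + 1 : ℕ) : ℝ) + 1) ^ 2) by ring, abs_of_nonneg hmin0]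
  exact hmin1

/-- **ROW-BOUNDED MODULI SERVE**: `HistLipschitz (fun k i ↦ 1∕(k−i+1)²) γ β` (`min` is 1-Lipschitz in its second argument). [folklore] -/
theorem fam_histLipschitz
    (hβ : ∀ (k : ℕ) (p : Fin (k + 1) → ℝ),
      β k p = b + ∑ i : Fin (k + 1), min (c * θ ^ (k - (i : ℕ))) (p i / (((k - (i : ℕ) : ℕ) : ℝ) + 1) ^ 2)) (γ : ℝ) :
    HistLipschitz (fun k i => 1 / (((k - i : ℕ) : ℝ) + 1) ^ 2) γ β := by
  intro k p q _ _
  rw [hβ k p, hβ k q, add_sub_add_left_eq_sub, ← sum_sub_distrib]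
  refine (abs_sum_le_sum_abs _ _).trans (sum_le_sum fun i _ => ?_)
  have hd : 0 < (((k - (i : ℕ) : ℕ) : ℝ) + 1) ^ 2 := by positivity
  calc |min (c * θ ^ (k - (i : ℕ))) (p i / (((k - (i : ℕ) : ℕ) : ℝ) + 1) ^ 2)
        - min (c * θ ^ (k - (i : ℕ))) (q i / (((k - (i : ℕ) : ℕ) : ℝ) + 1) ^ 2)|
      ≤ max |c * θ ^ (k - (i : ℕ)) - c * θ ^ (k - (i : ℕ))|
          |p i / (((k - (i : ℕ) : ℕ) : ℝ) + 1) ^ 2 - q i / (((k - (i : ℕ) : ℕ) : ℝ) + 1) ^ 2| :=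
        abs_min_sub_min_le_max _ _ _ _
    _ = |p i - q i| / (((k - (i : ℕ) : ℕ) : ℝ) + 1) ^ 2 := by
        rw [sub_self, abs_zero, ← sub_div, abs_div, abs_of_pos hd, max_eq_right (by positivity)]
    _ = 1 / (((k - (i : ℕ) : ℕ) : ℝ) + 1) ^ 2 * |p i - q i| := by ring

/-- `Σ_{a<n} 1∕(a+1)² ≤ 2 − 2∕(n+1)` (`1∕(a+1)² ≤ 2∕((a+1)(a+2))`, telescoped). [folklore] -/
theorem sum_inv_succ_sq_le (n : ℕ) : ∑ a ∈ range n, 1 / ((a : ℝ) + 1) ^ 2 ≤ 2 - 2 / ((n : ℝ) + 1) := by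
  induction n with
  | zero => simp
  | succ n ih =>
    rw [sum_range_succ]
    have hn : (0 : ℝ) < (n : ℝ) + 1 := by positivity
    have hstep : 1 / ((n : ℝ) + 1) ^ 2 ≤ 2 / ((n : ℝ) + 1) - 2 / ((n : ℝ) + 1 + 1) := by
      rw [div_sub_div _ _ hn.ne' (by positivity), div_le_div_iff₀ (by positivity) (by positivity)]
      nlinarith
    push_cast
    linarith

/-- **ROW TOTAL WEIGHT ≤ 2**: `Σ_{i≤k} 1∕(k−i+1)² = Σ_{a≤k} 1∕(a+1)² ≤ 2` — (D4-J2)'s junction currency is finite for the family, k-uniformly.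
[folklore] -/
theorem fam_rows_le_two (k : ℕ) : ∑ i ∈ range (k + 1), 1 / (((k - i : ℕ) : ℝ) + 1) ^ 2 ≤ 2 := by
  have e : ∑ i ∈ range (k + 1), 1 / (((k - i : ℕ) : ℝ) + 1) ^ 2 = ∑ a ∈ range (k + 1), 1 / ((a : ℝ) + 1) ^ 2 := by
    have h := sum_range_reflect (fun a => 1 / ((a : ℝ) + 1) ^ 2) (k + 1)
    rw [← h]
    refine sum_congr rfl fun i hi => ?_
    have hi' : i ≤ k := Nat.lt_succ_iff.mp (mem_range.mp hi)
    rw [show k + 1 - 1 - i = k - i by omega]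
  rw [e]
  have h := sum_inv_succ_sq_le (k + 1)
  have : 0 ≤ 2 / (((k + 1 : ℕ) : ℝ) + 1) := by positivity
  linarith

/-- FLOOR AND SIGN: `b ≤ β` on every box (each clipped ramp is `≥ 0` there; `c ≥ 0`, `θ ≥ 0`) — `BetaLowerH b γ β`, hence the sign for
`b ≥ 0` and `EventualLowerH b γ 0 β`. [folklore] -/
theorem fam_lower
    (hβ : ∀ (k : ℕ) (p : Fin (k + 1) → ℝ),
      β k p = b + ∑ i : Fin (k + 1), min (c * θ ^ (k - (i : ℕ))) (p i / (((k - (i : ℕ) : ℕ) : ℝ) + 1) ^ 2))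
    (hc : 0 ≤ c) (hθ0 : 0 ≤ θ) (γ : ℝ) : BetaLowerH b γ β := by
  intro k p hp
  rw [hβ k p]
  have : 0 ≤ ∑ i : Fin (k + 1), min (c * θ ^ (k - (i : ℕ))) (p i / (((k - (i : ℕ) : ℕ) : ℝ) + 1) ^ 2) :=
    sum_nonneg fun i _ => le_min (mul_nonneg hc (pow_nonneg hθ0 _))
      (div_nonneg ((mem_box.mp hp) i).1.le (by positivity))
  linarith

/-- UNIFORM BOUND: `β ≤ b + c∕(1−θ)` on every box (`0 ≤ θ < 1`: each clipped ramp is `≤ cθ^{k−i}`, a geometric sum) — the PRINTED-type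
«uniformly bounded» shape `BetaUpperH`. [folklore] -/
theorem fam_upper
    (hβ : ∀ (k : ℕ) (p : Fin (k + 1) → ℝ),
      β k p = b + ∑ i : Fin (k + 1), min (c * θ ^ (k - (i : ℕ))) (p i / (((k - (i : ℕ) : ℕ) : ℝ) + 1) ^ 2))
    (hc : 0 ≤ c) (hθ0 : 0 ≤ θ) (hθ1 : θ < 1) (γ : ℝ) : BetaUpperH (b + c / (1 - θ)) γ β := by
  intro k p _
  rw [hβ k p]
  have h1 : ∑ i : Fin (k + 1), min (c * θ ^ (k - (i : ℕ))) (p i / (((k - (i : ℕ) : ℕ) : ℝ) + 1) ^ 2)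
      ≤ ∑ i ∈ range (k + 1), c * θ ^ (k - i) := by
    rw [Finset.sum_range (fun i => c * θ ^ (k - i))]
    exact sum_le_sum fun i _ => min_le_left _ _
  have h2 : ∑ i ∈ range (k + 1), c * θ ^ (k - i) ≤ c / (1 - θ) := by
    rw [show ∑ i ∈ range (k + 1), c * θ ^ (k - i) = ∑ a ∈ range (k + 1), c * θ ^ a by
      rw [← sum_range_reflect (fun a => c * θ ^ a) (k + 1)]
      exact sum_congr rfl fun i hi => by rw [show k + 1 - 1 - i = k - i by omega], ← mul_sum]
    calc c * ∑ a ∈ range (k + 1), θ ^ a ≤ c * (θ ^ 0 / (1 - θ)) := by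
          rw [← Nat.Ico_zero_eq_range]; exact mul_le_mul_of_nonneg_left (geom_sum_Ico_le_of_lt_one hθ0 hθ1) hc
      _ = c / (1 - θ) := by rw [pow_zero]; ring
  linarith

/-! ## §2 No history-Lipschitz modulus of the family has fading memory -/

/-- **EVERY MODULUS WEIGHS THE BARE SLOT BY AT LEAST `1∕(k+1)²`**: if `HistLipschitz Λ′ γ β` (`γ > 0`, `c > 0`, `θ > 0`), then
`1∕(k+1)² ≤ Λ′ k 0` for every `k` — two histories in the box, equal except in the bare slot where both lie inside the age-`k` ramp
(`t = min γ (cθ^k)`, values `t` and `t∕2`), differ in `β` by exactly `(t∕2)∕(k+1)²`. [folklore] -/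
theorem fam_weight_ge
    (hβ : ∀ (k : ℕ) (p : Fin (k + 1) → ℝ),
      β k p = b + ∑ i : Fin (k + 1), min (c * θ ^ (k - (i : ℕ))) (p i / (((k - (i : ℕ) : ℕ) : ℝ) + 1) ^ 2))
    {Λ' : ℕ → ℕ → ℝ} {γ : ℝ} (hγ : 0 < γ) (hc : 0 < c) (hθ : 0 < θ) (hL : HistLipschitz Λ' γ β) (k : ℕ) :
    1 / ((k : ℝ) + 1) ^ 2 ≤ Λ' k 0 := by
  set t : ℝ := min γ (c * θ ^ k) with ht
  have ht0 : 0 < t := lt_min hγ (mul_pos hc (pow_pos hθ k))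
  have htγ : t ≤ γ := min_le_left _ _
  have htc : t ≤ c * θ ^ k := min_le_right _ _
  set q : Fin (k + 1) → ℝ := fun _ => t with hq
  set p : Fin (k + 1) → ℝ := Function.update q 0 (t / 2) with hp
  have hqbox : q ∈ Box γ k := mem_box.mpr fun _ => ⟨ht0, htγ⟩
  have hpbox : p ∈ Box γ k := mem_box.mpr fun i => by
    by_cases hi : i = 0
    · subst hi; simp only [hp, Function.update_self]; exact ⟨by linarith, by linarith⟩
    · simp only [hp, Function.update_of_ne hi, hq]; exact ⟨ht0, htγ⟩
  have h := hL k q p hqbox hpbox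
  -- the right-hand side: only the bare slot differs
  have hrhs : ∑ i : Fin (k + 1), Λ' k i * |q i - p i| = Λ' k 0 * (t / 2) := by
    rw [Fintype.sum_eq_single (0 : Fin (k + 1)) (fun i hi => by simp [hp, hq, Function.update_of_ne hi])]
    simp only [hp, hq, Function.update_self, Fin.val_zero]
    rw [show t - t / 2 = t / 2 by ring, abs_of_pos (by linarith)]
  -- the left-hand side: exactly (t/2)/(k+1)² (both bare values inside the ramp; other slots equal)
  have hd1 : (1 : ℝ) ≤ (((k - 0 : ℕ) : ℝ) + 1) ^ 2 := by
    have : (0 : ℝ) ≤ ((k - 0 : ℕ) : ℝ) := Nat.cast_nonneg _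
    nlinarith
  have hdpos : (0 : ℝ) < (((k - 0 : ℕ) : ℝ) + 1) ^ 2 := by positivity
  have hramp : ∀ x : ℝ, 0 ≤ x → x ≤ t →
      min (c * θ ^ (k - ((0 : Fin (k + 1)) : ℕ))) (x / (((k - ((0 : Fin (k + 1)) : ℕ) : ℕ) : ℝ) + 1) ^ 2)
        = x / (((k - 0 : ℕ) : ℝ) + 1) ^ 2 := by
    intro x hx0 hxt
    simp only [Fin.val_zero]
    refine min_eq_right ?_
    rw [Nat.sub_zero] at hdpos hd1 ⊢
    calc x / (((k : ℕ) : ℝ) + 1) ^ 2 ≤ x / 1 := div_le_div_of_nonneg_left hx0 one_pos hd1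
      _ ≤ c * θ ^ k := by rw [div_one]; exact hxt.trans htc
  have hlhs : β k q - β k p = (t / 2) / (((k - 0 : ℕ) : ℝ) + 1) ^ 2 := by
    rw [hβ k q, hβ k p, add_sub_add_left_eq_sub, ← sum_sub_distrib,
      Fintype.sum_eq_single (0 : Fin (k + 1)) (fun i hi => by simp [hp, hq, Function.update_of_ne hi])]
    simp only [hp, hq, Function.update_self]
    rw [hramp t ht0.le le_rfl, hramp (t / 2) (by linarith) (by linarith)]
    ring
  rw [hrhs, hlhs, Nat.sub_zero, abs_of_pos (by positivity)] at h
  -- (t/2)/(k+1)² ≤ Λ' k 0 · (t/2)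
  have ht2 : (0 : ℝ) < t / 2 := by linarith
  have h' : 1 / ((k : ℝ) + 1) ^ 2 * (t / 2) ≤ Λ' k 0 * (t / 2) := by
    calc 1 / ((k : ℝ) + 1) ^ 2 * (t / 2) = t / 2 / ((k : ℝ) + 1) ^ 2 := by ring
      _ ≤ Λ' k 0 * (t / 2) := h
  exact le_of_mul_le_mul_right h' ht2

/-- **NO FADING MODULUS**: for every modulus `Λ′` with `HistLipschitz Λ′ γ β` (`γ, c, θ > 0`), every `C` and every `θ′ ∈ [0,1[`,
`FadingMemory C θ′ Λ′` FAILS (it would force `1∕(k+1)² ≤ Cθ′^k` for all `k`, but `(k+1)²θ′^k → 0`).  So node U2's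
`disc_le_of_fadingMemory` ∕ `injectedRate_of_runs_eventual` ∕ `T4ContinuumCoupling.continuumRunning_of_runs_eventual` have NO instance for
this family, while (E33c)∕(E33d) apply (§1 + `fam_binders_E33`). [folklore] -/
theorem fam_not_fadingMemory
    (hβ : ∀ (k : ℕ) (p : Fin (k + 1) → ℝ),
      β k p = b + ∑ i : Fin (k + 1), min (c * θ ^ (k - (i : ℕ))) (p i / (((k - (i : ℕ) : ℕ) : ℝ) + 1) ^ 2))
    {Λ' : ℕ → ℕ → ℝ} {γ : ℝ} (hγ : 0 < γ) (hc : 0 < c) (hθ : 0 < θ) (hL : HistLipschitz Λ' γ β)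
    {C θ' : ℝ} (hθ'0 : 0 ≤ θ') (hθ'1 : θ' < 1) : ¬ FadingMemory C θ' Λ' := by
  intro hF
  have hw := fam_weight_ge hβ hγ hc hθ hL
  have hle : ∀ k : ℕ, 1 / ((k : ℝ) + 1) ^ 2 ≤ C * θ' ^ k := fun k => by
    have h := (hF k 0 (Nat.zero_le k)).2
    rw [Nat.sub_zero] at h
    exact (hw k).trans h
  rcases hθ'0.eq_or_lt with hz | hpos
  · -- θ' = 0: at k = 1 the bound reads 1/4 ≤ 0
    have h1 := hle 1
    rw [← hz] at h1
    norm_num at h1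
  · -- θ' > 0: θ' ≤ C·(k+1)²·θ'^(k+1) for all k, but the right-hand side tends to 0
    have hT : Tendsto (fun k : ℕ => C * ((((k + 1 : ℕ) : ℝ)) ^ 2 * θ' ^ (k + 1))) atTop (𝓝 (C * 0)) :=
      ((tendsto_pow_const_mul_const_pow_of_lt_one 2 hθ'0 hθ'1).comp (tendsto_add_atTop_nat 1)).const_mul C
    rw [mul_zero] at hT
    have hev := hT.eventually (gt_mem_nhds hpos)
    obtain ⟨k, hk⟩ := hev.exists
    have hk' : θ' ≤ C * ((((k + 1 : ℕ) : ℝ)) ^ 2 * θ' ^ (k + 1)) := by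
      have h := hle k
      have hd : (0 : ℝ) < ((k : ℝ) + 1) ^ 2 := by positivity
      rw [div_le_iff₀ hd] at h
      push_cast
      calc θ' = θ' * 1 := (mul_one _).symm
        _ ≤ θ' * (C * θ' ^ k * ((k : ℝ) + 1) ^ 2) := mul_le_mul_of_nonneg_left h hθ'0
        _ = C * (((k : ℝ) + 1) ^ 2 * θ' ^ (k + 1)) := by ring
    linarith

/-- **THE (E33) SIGN-FORM BINDERS ARE MET** (`c ≥ 0`, `0 ≤ θ < 1`, `b > 0`): `ScaleShiftRate c θ γ β`, `HistLipschitz Λ γ β` with `Λ ≥ 0` and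
rows `≤ 2`, the sign `BetaLowerH 0 γ β`, the floor `EventualLowerH b γ 0 β` — so (E33c) `disc_le_stretched_sign` ∕ (E33d)
`continuum_of_sign` apply to any pinned family of runs of this `β` in ]0,γ] as soon as `2·(γ³ + 2γ∕b) < 1`, although (§2) no modulus
of `β` has fading memory. [folklore] -/
theorem fam_binders_E33
    (hβ : ∀ (k : ℕ) (p : Fin (k + 1) → ℝ),
      β k p = b + ∑ i : Fin (k + 1), min (c * θ ^ (k - (i : ℕ))) (p i / (((k - (i : ℕ) : ℕ) : ℝ) + 1) ^ 2))
    (hb : 0 ≤ b) (hc : 0 ≤ c) (hθ0 : 0 ≤ θ) (hθ1 : θ < 1) (γ : ℝ) :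
    ScaleShiftRate c θ γ β ∧ HistLipschitz (fun k i => 1 / (((k - i : ℕ) : ℝ) + 1) ^ 2) γ β
      ∧ (∀ k i : ℕ, i ≤ k → (0 : ℝ) ≤ 1 / (((k - i : ℕ) : ℝ) + 1) ^ 2)
      ∧ (∀ k, ∑ i ∈ range (k + 1), 1 / (((k - i : ℕ) : ℝ) + 1) ^ 2 ≤ 2)
      ∧ BetaLowerH 0 γ β ∧ EventualLowerH b γ 0 β :=
  ⟨fam_scaleShiftRate hβ hc hθ0 hθ1.le γ, fam_histLipschitz hβ γ, fun k i _ => by positivity, fam_rows_le_two,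
    fun k p hp => hb.trans (fam_lower hβ hc hθ0 γ k p hp),
    eventualLowerH_of_betaLowerH (fam_lower hβ hc hθ0 γ) 0⟩

end Summit.QuantumFields.BalabanUV.Beta.EriceRemainderEnclosureHistoryRenewalSharp

end
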